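/-
Copyright (c) 2026 the pub-hodgecm-mathlib formalisation cell (harness21).  Text: the P2 desk F0P2-plan (g7) (spec `fe38b87cf0dd3bdb`, certified
`Iff.rfl` against the registered stub); filed by B-p18 (g27) on the director's word (α) (s551 (1), 2026-08-31).  Statement-only Literature module:
ONE named fact, no proof.
-/
import Literature.NumberTheory.Rogawski1990.CohomologicalFinComponentIsTheta
import Literature.NumberTheory.Automorphic.Liu2021.Def412AdmissibleIffParity
import HarnessLib

/-!
# [Rogawski 1990 + Gelbart–Rogawski 1991 + Liu 2021, Prop. 4.13 (proof, Case 1)] — the SIGNED theta realisation of a cotangent cohomological form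
# on the CM-pinned unitary group in three variables (letter (C♯)hol: `cohFinComponent_isThetaSigned_hol`)

Statement-only port (ONE NAMED FACT, used as a hypothesis `(h : cohFinComponent_isThetaSigned_hol)`).  This is the SIGNED form of ★ letter (C)
`Literature.NumberTheory.Rogawski1990.cohFinComponent_isTheta` (this directory): (C) says that every irreducible smooth `σ` occurring in the finite part
of a discrete automorphic `P` of Hodge type (1,0) or (0,1) at `ι` embeds into SOME Liu carrier `ω_H(μ, a, χ)` with `μ` conjugate-symplectic of weight
one; (C♯) says, in OCCURRENCE form and per Hodge type, that for a HOLOMORPHIC (resp. ANTIHOLOMORPHIC) cotangent `P` there is such a triple with the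
extra SIGN condition that `e := a·δ′` (`δ′ = (2·imagUnit L)⁻¹ ∈ L^{×−}`) is ADMISSIBLE for the CM type `Φ_μ` of `μ` in the sense of [Liu2021, Def. 4.12]
(`Literature.AlgebraicGeometry.Liu2021.IsAdmissibleElement`: `Im φ(e) < 0` for all `φ ∈ Φ_μ`), and `ω_H(μ, a, χ) ↪ P_f`.

READING.  [Liu2021, Prop. 4.13] proof, Case 1 (l. 2131–2146) and summary (l. 2147–2149): «if `π` contributes [to `H^{n−1}` of holomorphic type], then
`π^∞ ≅ ω(μ, ε, χ)` for a unique adèlic oscillator triple in which `μ` is of weight one and `ε` is `μ`-admissible» — via the pole of `L^S(s, π × μ)` at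
`s₀ = n∕2` [Liu2021, Thm. (th:pole), Cor. (co:pole2)], the global theta lift from a one-dimensional skew-hermitian space `𝕎` with discriminant line `e`,
and the archimedean Weil dictionary [Liu2021, Lem. (le:weil_arch)] («cohomological of degree one at `τ`, trivial at the compact places» ⟺ `μ` of weight one
and `Im τ⁺(e) < 0`); the print's Case 1 is the HOLOMORPHIC case («`H¹(𝔤, K_G; π_∞)` is of dimension 1», proof of Prop. 4.13, p. 48), and
[Liu2021, Def. 4.12, last sentence (p. 47, l. 2109)] reads «It is clear by Remark 4.4 that `ε` is `μ`-admissible if and only if `−ε` is `μᶜ`-admissible»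
(admissibility is conjugation-invariant) — hence a per-Hodge-type statement with ONE admissibility convention.  THIS FILE STATES THE HOLOMORPHIC ONE ONLY:
the antiholomorphic statement (the registered stub `StubCSharpAntihol`) is NOT a letter — it follows IN HOUSE from `cohFinComponent_isThetaSigned_hol` by
complex conjugation `P ↦ P̄`, `(μ, a, χ) ↦ (μ′, −a, χ̄)`, `Φ_{μ′} = Φ̄_μ` (exactly that last sentence, kernel-checked)
(★ `Summits/HodgeConjecture/HodgeConjecture/Theorems/F0P2mCSharpAntiholOfHol`, [Liu2021, App. D Lem. D.1 (2)]).  For `n = 3`: [Rogawski1990, Thm. 13.3.6 (c), §15.3 ¶1, §12.3] (the cohomological non-tempered spectrum is `⋃ Π(ξ)`, `dim ξ = 1`),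
[GelbartRogawski1991, Thm. 5.1.1, Lem. 5.1.2] (its members are theta lifts from `U(1)`), [Rogawski1992, Thm. 1.1] (which member is automorphic: the root
number).  The carrier `ω_H(μ, a, χ) = rhoAtLine …` and the frame telescope are those of letter (C) VERBATIM; the conclusion adds exactly the conjunct
`IsAdmissibleElement L hμ.cmType.1 (algebraMap L⁺ L a * (2 * imagUnit L)⁻¹)` and drops (C)'s auxiliary `σ`.

RELATION TO (C) (referee F0P2-ref1 r121 N121-1): (C♯) is a new letter TEXT, not «(C) + a conjunct»; (C) follows from (C♯)hol (and its antiholomorphic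
consequence) together with
finite isotypy of `P` (★ `Summits/…/Theorems/F0P2mFinIsotypy`, P3 brick I♭) and the irreducibility of the rank-3 carriers ([Liu2021, Lem. D.1 (1)], ★) — so
(C) is derived in house from (C♯) (★ `Summits/HodgeConjecture/HodgeConjecture/Theorems/F0P2mCOfCSharp`).  The text below is the body of the registered stub
`StubCSharpHol` of `Summits/HodgeConjecture/HodgeConjecture/Cruxes/H413/Lines/F0_P2E3Rung3.lean` (v1.1 0929a40a859b4f2f :220) CHARACTER FOR CHARACTER, so
that the fold is `stub_CSharp_hol := h` for `(h : cohFinComponent_isThetaSigned_hol)` supplied by the route's letter binder.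
HC_CM is proved only modulo the printed citations until rung 0 closes; filing this file ADDS one printed citation ((C♯)hol).
-/

noncomputable section

open NumberField NumberField.InfinitePlace MeasureTheory IsDedekindDomain
open scoped Matrix ComplexOrder

namespace Literature.NumberTheory.Rogawski1990

open Literature.NumberTheory Literature.NumberTheory.Automorphic Literature.NumberTheory.Automorphic.UnitaryGroup
open Literature.NumberTheory.Automorphic.UnitaryGroup.CotangentForms
open Literature.NumberTheory.Automorphic.Liu2021 Literature.NumberTheory.Automorphic.Liu2021.AppendixC
open Literature.NumberTheory.Automorphic.Liu2021.Def411WeilCarriers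
open Literature.NumberTheory.Automorphic.Liu2021.Def411WeilCarriersDoubling
open Literature.NumberTheory.Automorphic.IdeleClassGroup
open Literature.NumberTheory.GelbartRogawski1991 Literature.NumberTheory.GelbartRogawski1991.UnitaryDualPair
open Literature.NumberTheory.GelbartRogawski1991.UnitaryDualPair.WeilCoinv
open Literature.RepresentationTheory Literature.RepresentationTheory.Liu2021
open Literature.NumberTheory.QuadraticForms
open Literature.AlgebraicGeometry.Liu2021 (IsAdmissibleElement)

/-- **(C♯)hol [Liu2021, Prop. 4.13 proof Case 1 + summary; Rogawski1990 Thm. 13.3.6 (c); GelbartRogawski1991 Thm. 5.1.1; Rogawski1992 Thm. 1.1] —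
the signed theta realisation of a HOLOMORPHIC cotangent form on the CM-pinned `U(H)`, `n = 3`.**  Text = `StubCSharpHol` of
`Cruxes/H413/Lines/F0_P2E3Rung3.lean` VERBATIM.
[cite: Liu2021, Prop. 4.13 proof Case 1 (l. 2131–2146), summary (l. 2147–2149), Def. 4.12, Lem. (le:weil_arch)] [cite: Rogawski1990, Thm. 13.3.6 (c), §15.3 ¶1, §12.3 p. 174]
[cite: GelbartRogawski1991, Thm. 5.1.1 p. 465, Lem. 5.1.2 p. 466] [cite: Rogawski1992, Thm. 1.1] -/
def cohFinComponent_isThetaSigned_hol : Prop :=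
  ∀ (L : Type) [Field L] [NumberField L] [IsCMField L] (ι : L →+* ℂ) (H : Matrix (Fin 3) (Fin 3) L) (T : GL (Fin 3) ℂ)
    (hT : (T : Matrix (Fin 3) (Fin 3) ℂ)ᴴ * H.map ι * (T : Matrix (Fin 3) (Fin 3) ℂ) = Literature.Geometry.ComplexHyperbolic.BallModel.J),
    (∀ τ' : L →+* ℂ, InfinitePlace.mk τ' ≠ InfinitePlace.mk ι → (H.map τ').PosDef) → 2 ≤ Module.finrank ℚ ↥(maximalRealSubfield L) →
    ∀ {n' : ℕ} (e₁ : Fin 3 × Fin 1 ≃ Fin n') (dV : Fin 3 → L) (hdV : ∀ i, IsCMField.complexConj L (dV i) = dV i)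
      (hdV0 : ∀ i, dV i ≠ 0) (g : GL (Fin 3) L)
      (hg : ((g : Matrix (Fin 3) (Fin 3) L).map (cmConjRingHom L))ᵀ * H * (g : Matrix (Fin 3) (Fin 3) L) = Matrix.diagonal dV)
      (ιV : finAdelic (↥(maximalRealSubfield L)) L (IsCMField.complexConj L) 3 H →*
          finAdelic (↥(maximalRealSubfield L)) L (IsCMField.complexConj L) 3 (Matrix.diagonal dV)),
        (∀ k, ((ιV k : finAdelic (↥(maximalRealSubfield L)) L (IsCMField.complexConj L) 3 (Matrix.diagonal dV)) :
            GL (Fin 3) (FiniteAdeleRing (𝓞 L) L)) =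
          (toFinAdeleGL L 3 g)⁻¹ * (k : GL (Fin 3) (FiniteAdeleRing (𝓞 L) L)) * toFinAdeleGL L 3 g) →
        ∀ (μA : Measure (adelicGroupData (↥(maximalRealSubfield L)) L (IsCMField.complexConj L) 3 H).automorphicQuotient)
          [(adelicGroupData (↥(maximalRealSubfield L)) L (IsCMField.complexConj L) 3 H).IsAutomorphicMeasure μA],
          ∀ P : DiscreteAutomorphicRep (adelicGroupData (↥(maximalRealSubfield L)) L (IsCMField.complexConj L) 3 H) μA,
            P.IsHolCotangentAt (cmArchSection L ι H T hT) (cmCompactFactor L ι H T hT) →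
              ∃ (μ : Literature.NumberTheory.Automorphic.IdeleClassGroup L →ₜ* Circle) (hμ : IsConjugateSymplectic L μ),
                HasWeight L μ 1 ∧
                ∃ (a : (↥(maximalRealSubfield L))ˣ) (χ : Chi (↥(maximalRealSubfield L)) L (IsCMField.complexConj L)),
                  IsAdmissibleElement L hμ.cmType.1 (algebraMap (↥(maximalRealSubfield L)) L a * (2 * imagUnit L)⁻¹) ∧
                    P.HasFinComponent
                  (rhoAtLine (↥(maximalRealSubfield L)) L (IsCMField.complexConj L) 3 e₁ (Matrix.diagonal dV)
                    (complexConj_imagUnit L) (imagUnit_ne_zero L) (imagUnit_mul_self L) (realDiagonal_isSymm L dV hdV)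
                    (isUnit_det_realDiagonal L dV hdV hdV0) (realDiagonal_map L dV hdV).symm
                    (fun a => isCompatible_chiSplittingLine L e₁ dV hdV hdV0 (toHeckeCharacter L μ)
                      (isUnitary_toHeckeCharacter L μ) ((isOscillatorChar_toHeckeCharacter_iff μ).mpr hμ)
                      (TW (↥(maximalRealSubfield L)) a) (isSymm_TW (↥(maximalRealSubfield L)) a)
                      (isUnit_det_TW (↥(maximalRealSubfield L)) a) (JW (↥(maximalRealSubfield L)) L a)
                      (JW_eq (↥(maximalRealSubfield L)) L a)) ιV a χ)

end Literature.NumberTheory.Rogawski1990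

end
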